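import Literature.MathematicalPhysics.QuantumFieldTheory.BorinskyMunchTellander2023.SecondSymanzikLaplacian
import Mathlib.Analysis.Calculus.Deriv.Inv
import Mathlib.Analysis.Calculus.Deriv.Mul
import Mathlib.Analysis.Calculus.Deriv.Add
import HarnessLib

/-!
# Borinsky–Munch–Tellander 2023 §4.2 «Explicit formulas for the 𝒱 derivatives» AS PRINTED: `ℳ = 𝓛⁻¹𝒫𝓛⁻¹`, eq. (AB)'s `𝒜`, `ℬ`, «the matrix differentiation rule» `∂𝓛⁻¹/∂x_e = −𝓛⁻¹ (∂𝓛/∂x_e) 𝓛⁻¹`, and eq. (diffV): `∂𝒱/∂x_e = −𝒜_{e,e} + m_e²`, `∂²𝒱/∂x_e∂x_h = 2δ_{e,h} 𝒜_{e,e}/x_e − 2(𝒜∘ℬ)_{e,h}` — PROVED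

independent recomputation; certified where stated, statistical where stated; no new-physics claim.

CITATION HEADER (venture `QEDPrecision`, cell `pub-qed`, track TROPICAL, LIT seat `pub-qed-trop-lit` gen 33; VALUE-FREE: identities between
rational functions of the edge variables of an ARBITRARY edge list, an arbitrary matrix `𝒫` and arbitrary masses; no word, no integral, no
Monte-Carlo value). Sequel to `SecondSymanzikLaplacian.lean` (same seat, same day: (eq:laplaceUF)'s second identity `ℱ = 𝒰·(−Σ 𝒫 𝓛⁻¹ + Σ m² x)`,
whose header lists «NOT typed: (eq:AB)/(eq:diffV) (the 𝒱-derivatives through ℳ = 𝓛⁻¹𝒫𝓛⁻¹)»), to `GraphLaplacian.lean` (𝓛(x), `𝓛 ≻ 0`) and to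
`ContourDeformation.lean` (§2.3: the deformation `X_e = x_e exp(−iλ ∂𝒱/∂x_e)` and the Jacobian `𝒥_λ = δ − iλ x ∂²𝒱` take a gradient vector and
a Hessian as INPUT — this file supplies the printed formulas that feyntrop evaluates for them, §4.2 steps 3–5).

SOURCE, VERBATIM. [BorinskyMunchTellander2023] M. Borinsky, H. J. Munch, F. Tellander, *Tropical Feynman integration in the Minkowski
regime*, Comput. Phys. Commun. 292 (2023) 108874 = arXiv:2302.08955v2 (HOME `data/lit/sources/.cache/2302.08955/main.tex`), §4.2
(l.1059–1072): "**Explicit formulas for the 𝒱 derivatives.** We need explicit formulas for the derivatives of 𝒱. These formulas provide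
fast evaluation methods for X and the Jacobian 𝒥_λ(x). Consider the (|V|−1)×(|V|−1) matrix ℳ(x) = 𝓛⁻¹(x) 𝒫 𝓛⁻¹(x) with 𝓛(x) and 𝒫 as
defined in Section 2. For edges e and h that connect the vertices u_e,v_e and u_h,v_h respectively, we define (eq:AB)
𝒜(x)_{e,h} = (1/(x_e x_h)) (ℳ(x)_{u_e,u_h} + ℳ(x)_{v_e,v_h} − ℳ(x)_{u_e,v_h} − ℳ(x)_{v_e,u_h}),
ℬ(x)_{e,h} = (1/(x_e x_h)) (𝓛⁻¹(x)_{u_e,u_h} + 𝓛⁻¹(x)_{v_e,v_h} − 𝓛⁻¹(x)_{u_e,v_h} − 𝓛⁻¹(x)_{v_e,u_h}), where we agree that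
𝓛⁻¹(x)_{u,v} = ℳ(x)_{u,v} = 0 if any of u or v is equal to v_0, the arbitrary vertex that was removed in the initial expression of the
Feynman integral (eq:prop). It follows from (eq:laplaceUF) and the matrix differentiation rule ∂/∂x_e 𝓛⁻¹(x)_{u,v} = (−𝓛⁻¹(x) ∂𝓛/∂x_e(x)
𝓛⁻¹(x))_{u,v} that (eq:diffV) ∂𝒱/∂x_e (x) = −𝒜(x)_{e,e} + m_e², ∂²𝒱/∂x_e∂x_h (x) = 2δ_{e,h} 𝒜(x)_{e,e}/x_e − 2(𝒜(x)∘ℬ(x))_{e,h}, where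
we use the Hadamard or element-wise matrix product, (𝒜(x)∘ℬ(x))_{e,h} = 𝒜(x)_{e,h}·ℬ(x)_{e,h}." Steps (l.1081–1088): "2. Compute the
inverse 𝓛⁻¹(x) … 3. Use this to evaluate the derivatives of 𝒱(x) via the formulas in (eq:AB) and (eq:diffV). 4. Compute the values of the
deformed X parameters: X_e = x_e exp(−iλ ∂𝒱/∂x_e (x)). 5. Compute the Jacobian 𝒥_λ(x) using the formula in (eq:Jlambda)."

WHAT IS TYPED (edge list `E : Fin N → Fin (V+1) × Fin (V+1)`, root `v_0 = 0`; scalars in any nontrivially normed field `𝕜` — the print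
differentiates at real `x`; `𝓛(x) = laplacian E x` of `GraphLaplacian.lean`; a partial derivative `∂/∂x_e` at `x` is the derivative of
`t ↦ f(x with x_e := t)` at `t = x_e`, Mathlib's `HasDerivAt … (Function.update x e ·)`; hypotheses throughout: `x_e ≠ 0` (all edges) and
`det 𝓛(x) ≠ 0` — automatic at `x > 0` on a connected graph, the `…_of_pos` corollaries):
* DEFINITIONS WITH BODIES: `incRow E e` (the reduced incidence row `r_e = e_{u_e} − e_{v_e}`, root coordinate dropped); `quotientV E 𝒫 m x =
  −Σ_{u,v∈V∖{v_0}} 𝒫^{u,v} 𝓛⁻¹(x)_{u,v} + Σ_e m_e² x_e` (= `ℱ/𝒰` for real symmetric conserved `𝒫`: `quotientV_eq_eval_div`); `scriptM E 𝒫 x =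
  𝓛⁻¹ 𝒫' 𝓛⁻¹` (`𝒫'` the non-root block); `scriptA E 𝒫 x e h = (x_e x_h)⁻¹ r_eᵀ ℳ r_h`; `scriptB E x e h = (x_e x_h)⁻¹ r_eᵀ 𝓛⁻¹ r_h`;
  `rootExt M` (a matrix on `V∖{v_0}` extended by `0` to `v_0` — the printed convention); and **eq. (AB) LITERALLY**: `scriptA_eq_rootExt` /
  `scriptB_eq_rootExt` (`𝒜_{e,h} = (1/(x_e x_h))(ℳ°_{u_e,u_h} + ℳ°_{v_e,v_h} − ℳ°_{u_e,v_h} − ℳ°_{v_e,u_h})`, the same for `ℬ` with `𝓛⁻¹`), via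
  `incRow_dotProduct_mulVec` (`r_eᵀ M r_h` = the four-term combination for any `M`);
* «THE MATRIX DIFFERENTIATION RULE» for an ARBITRARY entrywise differentiable matrix curve at an invertible point —
  **`hasDerivAt_inv_apply`**: `∂(A⁻¹)_{ij} = −(A⁻¹ A' A⁻¹)_{ij}` (differentiate `A A⁻¹ = 1`, which holds on a neighbourhood by continuity of
  `det`; the entries of `A⁻¹ = det⁻¹·adj` are differentiable by Leibniz expansion);
* `hasDerivAt_laplacian_update` (`∂𝓛_{ik}/∂x_e = −ℰ_{i,e}ℰ_{k,e}/x_e²`), `laplacianDeriv_eq` (`∂𝓛/∂x_e = −x_e⁻² r_e r_eᵀ`),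
  `isSymm_inv_laplacian`, **`hasDerivAt_inv_laplacian_update`** (`∂𝓛⁻¹_{ik}/∂x_e = x_e⁻² (𝓛⁻¹r_e)_i (𝓛⁻¹r_e)_k`);
* **`hasDerivAt_quotientV_update` — eq. (diffV), FIRST FORMULA `∂𝒱/∂x_e = −𝒜_{e,e} + m_e²`** (any `𝒫`, no symmetry or conservation
  needed), `…_of_pos`;
* `transpose_scriptM` (ℳ symmetric for symmetric `𝒫`), `hasDerivAt_scriptM_update_apply` (`∂ℳ/∂x_h = D𝒫'𝓛⁻¹ + 𝓛⁻¹𝒫'D`,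
  `D = x_h⁻² (𝓛⁻¹r_h)(𝓛⁻¹r_h)ᵀ`), `hasDerivAt_quadForm_scriptM_update` (`∂(r_eᵀℳr_e)/∂x_h = 2x_e² 𝒜_{e,h}ℬ_{e,h}`), and
  **`hasDerivAt_partialV_update` — eq. (diffV), SECOND FORMULA**: the `x_h`-derivative of `−𝒜_{e,e} + m_e²` is
  `2δ_{e,h}𝒜_{e,e}/x_e − 2𝒜_{e,h}ℬ_{e,h}` for symmetric `𝒫`; `…_of_pos`.

PROOF ROUTE (the printed one). `∂𝓛/∂x_e = −x_e⁻² r_e r_eᵀ` from the entry formula; the matrix differentiation rule gives `∂𝓛⁻¹/∂x_e =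
x_e⁻² 𝓛⁻¹ r_e r_eᵀ 𝓛⁻¹`; then `∂(−Σ 𝒫 𝓛⁻¹)/∂x_e = −x_e⁻² (𝓛⁻¹r_e)ᵀ 𝒫' (𝓛⁻¹r_e) = −x_e⁻² r_eᵀ ℳ r_e = −𝒜_{e,e}` (symmetry of 𝓛⁻¹); for the
second formula `r_eᵀ(∂ℳ/∂x_h)r_e = x_h⁻²·[(r_eᵀ𝓛⁻¹r_h)(r_hᵀℳr_e) + (r_eᵀℳr_h)(r_hᵀ𝓛⁻¹r_e)] = 2x_e² 𝒜_{e,h}ℬ_{e,h}` (symmetry of `ℳ` for symmetric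
`𝒫`) and the prefactor `(x_e²)⁻¹` contributes `−2δ_{e,h}𝒜_{e,e}/x_e`.

NOT typed: (eq:Jlambda) and the assembly of steps 4–9 into the sampler (A46's `iotaDeform` / `jacobianJ` take the gradient and Hessian as
data — instantiating them with `−𝒜_{e,e} + m_e²` and this Hessian is bookkeeping left to the user); the complexity sentences; Euler /
homogeneity relations among the derivatives; complex `x` needs no change (𝕜 arbitrary) but the real `ℱ` at complex `X` stays as in the
companion. presearch (g33): none beyond A49's (the matrix differentiation rule is [folklore]; Mathlib has `hasFDerivAt_ringInverse` in
normed rings, not used — the entrywise route avoids choosing a matrix norm). (Filed by trop-lit g33, SOURCES A50; VALUE-FREE.)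
-/

noncomputable section

open Matrix Finset Filter Topology

namespace Literature.MathematicalPhysics.QuantumFieldTheory.BorinskyMunchTellander2023

open Literature.MathematicalPhysics.QuantumFieldTheory

/-! ### Part 1 — «the matrix differentiation rule» `∂(A⁻¹) = −A⁻¹ (∂A) A⁻¹` for an entrywise differentiable matrix curve -/

section MatrixCalculus

variable {𝕜 : Type*} [NontriviallyNormedField 𝕜] {n : Type*} [Fintype n] [DecidableEq n]

/-- The determinant of an entrywise differentiable matrix curve is differentiable (Leibniz expansion). [folklore] -/
private theorem differentiableAt_det {A : 𝕜 → Matrix n n 𝕜} {t : 𝕜}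
    (hA : ∀ i j, DifferentiableAt 𝕜 (fun s => A s i j) t) :
    DifferentiableAt 𝕜 (fun s => (A s).det) t := by
  simp_rw [Matrix.det_apply']
  refine DifferentiableAt.fun_sum fun σ _ => ?_
  refine DifferentiableAt.const_mul ?_ _
  exact DifferentiableAt.fun_finsetProd fun i _ => hA (σ i) i

/-- The adjugate of an entrywise differentiable matrix curve is entrywise differentiable. [folklore] -/
private theorem differentiableAt_adjugate_apply {A : 𝕜 → Matrix n n 𝕜} {t : 𝕜}
    (hA : ∀ i j, DifferentiableAt 𝕜 (fun s => A s i j) t) (i j : n) :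
    DifferentiableAt 𝕜 (fun s => (A s).adjugate i j) t := by
  simp_rw [Matrix.adjugate_apply]
  refine differentiableAt_det fun a b => ?_
  by_cases h : a = j
  · subst h
    simp only [Matrix.updateRow_self]
    exact differentiableAt_const _
  · simp only [Matrix.updateRow_ne h]
    exact hA a b

/-- The inverse of an entrywise differentiable matrix curve is entrywise differentiable where `det ≠ 0`. [folklore] -/
private theorem differentiableAt_inv_apply {A : 𝕜 → Matrix n n 𝕜} {t : 𝕜}
    (hA : ∀ i j, DifferentiableAt 𝕜 (fun s => A s i j) t) (hdet : (A t).det ≠ 0) (i j : n) :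
    DifferentiableAt 𝕜 (fun s => (A s)⁻¹ i j) t := by
  have h : ∀ s, (A s)⁻¹ i j = ((A s).det)⁻¹ * (A s).adjugate i j := fun s => by
    rw [Matrix.inv_def, Ring.inverse_eq_inv, Matrix.smul_apply, smul_eq_mul]
  simp_rw [h]
  exact ((differentiableAt_det hA).inv hdet).mul (differentiableAt_adjugate_apply hA i j)

/-- **«the matrix differentiation rule ∂/∂x_e 𝓛⁻¹(x)_{u,v} = (−𝓛⁻¹(x) ∂𝓛/∂x_e(x) 𝓛⁻¹(x))_{u,v}»** for an arbitrary
entrywise differentiable matrix curve `A` at a point where `det A ≠ 0`: the entries of `s ↦ (A s)⁻¹` have derivatives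
`−(A⁻¹ A' A⁻¹)_{ij}` (differentiate `A·A⁻¹ = 1`, which holds on a neighbourhood since `det` is continuous).
[cite: BorinskyMunchTellander2023, §4.2 before eq. (diffV) (main.tex l.1067)] -/
theorem hasDerivAt_inv_apply {A : 𝕜 → Matrix n n 𝕜} {A' : Matrix n n 𝕜} {t : 𝕜}
    (hA : ∀ i j, HasDerivAt (fun s => A s i j) (A' i j) t) (hdet : (A t).det ≠ 0) (i j : n) :
    HasDerivAt (fun s => (A s)⁻¹ i j) (-((A t)⁻¹ * A' * (A t)⁻¹) i j) t := by
  have hAd : ∀ i j, DifferentiableAt 𝕜 (fun s => A s i j) t := fun i j => (hA i j).differentiableAt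
  set D : Matrix n n 𝕜 := Matrix.of fun i j => deriv (fun s => (A s)⁻¹ i j) t with hD
  have hB : ∀ i j, HasDerivAt (fun s => (A s)⁻¹ i j) (D i j) t := fun i j =>
    (differentiableAt_inv_apply hAd hdet i j).hasDerivAt
  -- `A s * (A s)⁻¹ = 1` near `t`
  have hcont : ContinuousAt (fun s => (A s).det) t := (differentiableAt_det hAd).continuousAt
  have hev : ∀ᶠ s in 𝓝 t, (A s).det ≠ 0 := hcont.eventually_ne hdet
  have hprod : ∀ i j, HasDerivAt (fun s => ∑ k, A s i k * (A s)⁻¹ k j) ((A' * (A t)⁻¹ + A t * D) i j) t := by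
    intro i j
    have h := HasDerivAt.fun_sum (u := Finset.univ) fun k _ => (hA i k).mul (hB k j)
    simp only [Matrix.add_apply, Matrix.mul_apply, ← Finset.sum_add_distrib]
    refine h.congr_deriv (Finset.sum_congr rfl fun k _ => ?_)
    ring
  have hzero : ∀ i j, HasDerivAt (fun s => ∑ k, A s i k * (A s)⁻¹ k j) 0 t := by
    intro i j
    refine (hasDerivAt_const t ((1 : Matrix n n 𝕜) i j)).congr_of_eventuallyEq ?_
    filter_upwards [hev] with s hs
    rw [← Matrix.mul_apply, Matrix.mul_nonsing_inv _ (isUnit_iff_ne_zero.mpr hs)]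
  have hmat : A' * (A t)⁻¹ + A t * D = 0 := by
    ext i j
    rw [Matrix.zero_apply]
    exact (hprod i j).unique (hzero i j)
  have hU : IsUnit (A t).det := isUnit_iff_ne_zero.mpr hdet
  have hDeq : D = -((A t)⁻¹ * A' * (A t)⁻¹) := by
    have h1 : (A t)⁻¹ * (A' * (A t)⁻¹ + A t * D) = 0 := by rw [hmat, Matrix.mul_zero]
    rw [Matrix.mul_add, ← Matrix.mul_assoc, ← Matrix.mul_assoc, Matrix.nonsing_inv_mul _ hU,
      Matrix.one_mul] at h1
    exact eq_neg_of_add_eq_zero_right h1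
  have := hB i j
  rwa [hDeq] at this

end MatrixCalculus

/-! ### Part 2 — `∂𝓛/∂x_e` and `∂𝓛⁻¹/∂x_e` for BMT23's reduced Laplacian -/

section Laplacian

variable {𝕜 : Type*} [NontriviallyNormedField 𝕜]
variable {N V : ℕ} (E : Fin N → Fin (V + 1) × Fin (V + 1))

/-- The reduced incidence ROW `r_e = (ℰ_{u,e})_{u ∈ V∖{v_0}}` of the edge `e` (`= e_{u_e} − e_{v_e}` with the root coordinate
dropped), as a vector on the non-root vertices. [cite: BorinskyMunchTellander2023, §2.1 (main.tex l.294–296)] -/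
def incRow (e : Fin N) : Fin V → 𝕜 := fun j => reducedIncidence 𝕜 E e j

/-- Entries of `incRow`. [cite: BorinskyMunchTellander2023, §2.1 (main.tex l.294–296)] -/
@[simp] theorem incRow_apply (e : Fin N) (j : Fin V) : incRow (𝕜 := 𝕜) E e j = reducedIncidence 𝕜 E e j := rfl

/-- **`∂𝓛(x)_{ik}/∂x_e = −ℰ_{i,e} ℰ_{k,e}/x_e²`** (the Laplacian is `Σ_e ℰ_{u,e}ℰ_{v,e}/x_e`): the partial derivative along the
`e`-th edge variable, as the derivative of `t ↦ 𝓛(x with x_e := t)` at `t = x_e ≠ 0`.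
[cite: BorinskyMunchTellander2023, §2.1 (main.tex l.294–296) with §4.2 (main.tex l.1067)] -/
theorem hasDerivAt_laplacian_update (x : Fin N → 𝕜) {e : Fin N} (hxe : x e ≠ 0) (i k : Fin V) :
    HasDerivAt (fun t => laplacian E (Function.update x e t) i k)
      (-(reducedIncidence 𝕜 E e i * reducedIncidence 𝕜 E e k) / x e ^ 2) (x e) := by
  simp only [laplacian_apply]
  have key : ∀ e', HasDerivAt (fun t => reducedIncidence 𝕜 E e' i * reducedIncidence 𝕜 E e' k / Function.update x e t e')
      (if e' = e then -(reducedIncidence 𝕜 E e i * reducedIncidence 𝕜 E e k) / x e ^ 2 else 0) (x e) := by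
    intro e'
    by_cases h : e' = e
    · subst h
      simp only [Function.update_self, if_true]
      have h1 := (hasDerivAt_inv hxe).const_mul (reducedIncidence 𝕜 E e' i * reducedIncidence 𝕜 E e' k)
      refine (h1.congr_of_eventuallyEq (Filter.Eventually.of_forall fun t => ?_)).congr_deriv ?_
      · simp only [div_eq_mul_inv]
      · ring
    · simp only [Function.update_of_ne h, if_neg h]
      exact hasDerivAt_const _ _
  have hs := HasDerivAt.fun_sum (u := Finset.univ) fun e' _ => key e'
  rwa [Finset.sum_ite_eq' Finset.univ e, if_pos (Finset.mem_univ e)] at hs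

/-- The matrix `∂𝓛/∂x_e = −x_e⁻² · r_e r_eᵀ` with `r_e` the reduced incidence row of the edge `e`.
[cite: BorinskyMunchTellander2023, §2.1 (main.tex l.294–296) with §4.2 (main.tex l.1067)] -/
theorem laplacianDeriv_eq (x : Fin N → 𝕜) (e : Fin N) :
    (Matrix.of fun i k : Fin V => -(reducedIncidence 𝕜 E e i * reducedIncidence 𝕜 E e k) / x e ^ 2) =
      -((x e ^ 2)⁻¹ • vecMulVec (incRow (𝕜 := 𝕜) E e) (incRow E e)) := by
  ext i k
  simp only [Matrix.of_apply, Matrix.neg_apply, Matrix.smul_apply, vecMulVec_apply, smul_eq_mul, incRow_apply]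
  ring

/-- `𝓛⁻¹(x)` is symmetric. [cite: BorinskyMunchTellander2023, §4.2 (main.tex l.1095) ("hermitian … 𝓛(x)")] -/
theorem isSymm_inv_laplacian (x : Fin N → 𝕜) : ((laplacian E x)⁻¹).IsSymm := by
  have h := isSymm_laplacian E x
  unfold Matrix.IsSymm at h ⊢
  rw [Matrix.transpose_nonsing_inv, h]

/-- **`∂𝓛⁻¹(x)_{ik}/∂x_e = x_e⁻² (𝓛⁻¹ r_e)_i (𝓛⁻¹ r_e)_k`** — the matrix differentiation rule applied to `∂𝓛/∂x_e = −x_e⁻² r_e r_eᵀ`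
at a point with `x_e ≠ 0`, `det 𝓛(x) ≠ 0`. [cite: BorinskyMunchTellander2023, §4.2 before eq. (diffV) (main.tex l.1067)] -/
theorem hasDerivAt_inv_laplacian_update (x : Fin N → 𝕜) {e : Fin N} (hxe : x e ≠ 0) (hdet : (laplacian E x).det ≠ 0)
    (i k : Fin V) :
    HasDerivAt (fun t => (laplacian E (Function.update x e t))⁻¹ i k)
      ((x e ^ 2)⁻¹ * (((laplacian E x)⁻¹ *ᵥ incRow E e) i * ((laplacian E x)⁻¹ *ᵥ incRow E e) k)) (x e) := by
  have hA : ∀ i k, HasDerivAt (fun t => laplacian E (Function.update x e t) i k)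
      ((Matrix.of fun i k : Fin V => -(reducedIncidence 𝕜 E e i * reducedIncidence 𝕜 E e k) / x e ^ 2) i k) (x e) :=
    fun i k => by simpa only [Matrix.of_apply] using hasDerivAt_laplacian_update E x hxe i k
  have hdet' : (laplacian E (Function.update x e (x e))).det ≠ 0 := by rwa [Function.update_eq_self]
  have h := hasDerivAt_inv_apply hA hdet' i k
  rw [Function.update_eq_self, laplacianDeriv_eq] at h
  refine h.congr_deriv ?_
  have hs := isSymm_inv_laplacian E x
  unfold Matrix.IsSymm at hs
  have hvm : incRow E e ᵥ* (laplacian E x)⁻¹ = (laplacian E x)⁻¹ *ᵥ incRow E e := by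
    rw [← vecMul_transpose, hs]
  simp only [Matrix.mul_neg, Matrix.neg_mul, neg_neg, Matrix.neg_apply, Matrix.mul_smul, Matrix.smul_mul,
    mul_vecMulVec, vecMulVec_mul, Matrix.smul_apply, vecMulVec_apply, smul_eq_mul, hvm]

/-- `r_e ᵥ* 𝓛⁻¹ = 𝓛⁻¹ *ᵥ r_e` (symmetry). [cite: BorinskyMunchTellander2023, §4.2 (main.tex l.1095)] -/
theorem incRow_vecMul_inv_laplacian (x : Fin N → 𝕜) (e : Fin N) :
    incRow E e ᵥ* (laplacian E x)⁻¹ = (laplacian E x)⁻¹ *ᵥ incRow E e := by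
  have hs := isSymm_inv_laplacian E x
  unfold Matrix.IsSymm at hs
  rw [← vecMul_transpose, hs]

end Laplacian

/-! ### Part 3 — BMT23 §4.2: `ℳ = 𝓛⁻¹𝒫𝓛⁻¹`, eq. (AB)'s `𝒜`, `ℬ`, the quotient `𝒱` and eq. (diffV), first formula -/

section DiffV

variable {𝕜 : Type*} [NontriviallyNormedField 𝕜]
variable {N V : ℕ} (E : Fin N → Fin (V + 1) × Fin (V + 1))

/-- **`𝒱(x) = −Σ_{u,v∈V∖{v_0}} 𝒫^{u,v} 𝓛⁻¹(x)_{u,v} + Σ_e m_e² x_e`** — the quotient `ℱ/𝒰` of (eq:laplaceUF) as a FUNCTION of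
the edge variables (for real symmetric conserved `𝒫` and `𝒰(x) ≠ 0` it IS `ℱ(x)/𝒰(x)`:
`SecondSymanzikLaplacian.eval_gramSecondSymanzik_div_kirchhoffEval`); `𝒫` enters through its non-root block.
[cite: BorinskyMunchTellander2023, §2.1 eq. (laplaceUF) (main.tex l.291–300)] -/
def quotientV (P : Matrix (Fin (V + 1)) (Fin (V + 1)) 𝕜) (m : Fin N → 𝕜) (x : Fin N → 𝕜) : 𝕜 :=
  -(∑ i : Fin V, ∑ k : Fin V, P i.succ k.succ * (laplacian E x)⁻¹ i k) + ∑ e, m e ^ 2 * x e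

/-- For a real symmetric `𝒫` with vanishing row sums `𝒱(x)` IS `ℱ(x)/𝒰(x)` wherever `x_e ≠ 0`, `det 𝓛(x) ≠ 0`
(`SecondSymanzikLaplacian.eval_gramSecondSymanzik_div_kirchhoffEval`). [cite: BorinskyMunchTellander2023, §2.1 eq. (laplaceUF) (main.tex l.291–300)] -/
theorem quotientV_eq_eval_div {P : Matrix (Fin (V + 1)) (Fin (V + 1)) ℝ} (hP : P.IsSymm) (hcons : ∀ u, ∑ v, P u v = 0)
    (m : Fin N → ℝ) {x : Fin N → ℝ} (hx : ∀ e, x e ≠ 0) (hdet : (laplacian E x).det ≠ 0) :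
    quotientV E P m x = MvPolynomial.eval x (gramSecondSymanzik E P m) / kirchhoffEval E x := by
  rw [eval_gramSecondSymanzik_div_kirchhoffEval E hP hcons m hx hdet, quotientV]

/-- **`ℳ(x) = 𝓛⁻¹(x) 𝒫 𝓛⁻¹(x)`**, "the (|V|−1)×(|V|−1) matrix" of §4.2 (`𝒫` through its non-root block).
[cite: BorinskyMunchTellander2023, §4.2 (main.tex l.1062–1063)] -/
def scriptM (P : Matrix (Fin (V + 1)) (Fin (V + 1)) 𝕜) (x : Fin N → 𝕜) : Matrix (Fin V) (Fin V) 𝕜 :=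
  (laplacian E x)⁻¹ * P.submatrix Fin.succ Fin.succ * (laplacian E x)⁻¹

/-- **eq. (AB), first line: `𝒜(x)_{e,h} = (1/(x_e x_h))·(ℳ_{u_e,u_h} + ℳ_{v_e,v_h} − ℳ_{u_e,v_h} − ℳ_{v_e,u_h})`**, typed as
`(x_e x_h)⁻¹ · r_eᵀ ℳ r_h` with `r_e` the reduced incidence row of `e` (the four-term form with the `v_0` convention is
`scriptA_eq_rootExt`). [cite: BorinskyMunchTellander2023, §4.2 eq. (AB) (main.tex l.1064–1066)] -/
def scriptA (P : Matrix (Fin (V + 1)) (Fin (V + 1)) 𝕜) (x : Fin N → 𝕜) (e h : Fin N) : 𝕜 :=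
  (x e * x h)⁻¹ * (incRow E e ⬝ᵥ scriptM E P x *ᵥ incRow E h)

/-- **eq. (AB), second line: `ℬ(x)_{e,h} = (1/(x_e x_h))·(𝓛⁻¹_{u_e,u_h} + 𝓛⁻¹_{v_e,v_h} − 𝓛⁻¹_{u_e,v_h} − 𝓛⁻¹_{v_e,u_h})`**, typed as
`(x_e x_h)⁻¹ · r_eᵀ 𝓛⁻¹ r_h`. [cite: BorinskyMunchTellander2023, §4.2 eq. (AB) (main.tex l.1064–1066)] -/
def scriptB (x : Fin N → 𝕜) (e h : Fin N) : 𝕜 :=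
  (x e * x h)⁻¹ * (incRow E e ⬝ᵥ (laplacian E x)⁻¹ *ᵥ incRow E h)

/-- A matrix on the non-root vertices extended by `0` to the root: "we agree that 𝓛⁻¹(x)_{u,v} = ℳ(x)_{u,v} = 0 if any of u or
v is equal to v_0". [cite: BorinskyMunchTellander2023, §4.2 (main.tex l.1066)] -/
def rootExt (M : Matrix (Fin V) (Fin V) 𝕜) : Fin (V + 1) → Fin (V + 1) → 𝕜 :=
  fun u v => Fin.cases 0 (fun i => Fin.cases 0 (fun k => M i k) v) u

/-- The indicator row of a vertex with the root dropped: `δ°_w j = [w = j+1]`. [folklore] -/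
private def vtxRow (w : Fin (V + 1)) : Fin V → 𝕜 := fun j => if w = j.succ then 1 else 0

/-- The root has the zero row. [folklore] -/
private theorem vtxRow_zero : (vtxRow (𝕜 := 𝕜) (0 : Fin (V + 1))) = 0 := by
  funext j; simp [vtxRow, (Fin.succ_ne_zero j).symm]

/-- A non-root vertex `i+1` has the unit row `e_i`. [folklore] -/
private theorem vtxRow_succ (i : Fin V) : (vtxRow (𝕜 := 𝕜) i.succ) = Pi.single i 1 := by
  funext j
  by_cases h : i = j
  · subst h; simp [vtxRow]
  · have h' : j ≠ i := fun h' => h h'.symm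
    simp [vtxRow, h, h', Fin.succ_inj]

/-- `r_e = δ°_{u_e} − δ°_{v_e}`. [folklore] -/
private theorem incRow_eq (e : Fin N) :
    incRow (𝕜 := 𝕜) E e = vtxRow (E e).1 - vtxRow (E e).2 := by
  funext j; simp [incRow, reducedIncidence_apply, vtxRow]

/-- `δ°_uᵀ M δ°_v = M°_{u,v}` (zero when `u` or `v` is the root). [folklore] -/
private theorem vtxRow_dotProduct_mulVec_vtxRow (M : Matrix (Fin V) (Fin V) 𝕜) (u v : Fin (V + 1)) :
    vtxRow u ⬝ᵥ M *ᵥ vtxRow v = rootExt M u v := by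
  cases u using Fin.cases with
  | zero => simp [vtxRow_zero, rootExt]
  | succ i =>
    cases v using Fin.cases with
    | zero => simp [vtxRow_zero, rootExt]
    | succ k =>
      rw [vtxRow_succ, vtxRow_succ, mulVec_single_one, single_one_dotProduct, col_apply]
      simp [rootExt]

/-- `r_eᵀ M r_h = M°_{u_e,u_h} + M°_{v_e,v_h} − M°_{u_e,v_h} − M°_{v_e,u_h}` with `M°` the extension by zero to the root — the
printed four-term form of eq. (AB) for any matrix `M` on the non-root vertices.
[cite: BorinskyMunchTellander2023, §4.2 eq. (AB) (main.tex l.1064–1066)] -/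
theorem incRow_dotProduct_mulVec (M : Matrix (Fin V) (Fin V) 𝕜) (e h : Fin N) :
    incRow E e ⬝ᵥ M *ᵥ incRow E h =
      rootExt M (E e).1 (E h).1 + rootExt M (E e).2 (E h).2 - rootExt M (E e).1 (E h).2 - rootExt M (E e).2 (E h).1 := by
  rw [incRow_eq, incRow_eq, mulVec_sub, sub_dotProduct, dotProduct_sub, dotProduct_sub,
    vtxRow_dotProduct_mulVec_vtxRow, vtxRow_dotProduct_mulVec_vtxRow, vtxRow_dotProduct_mulVec_vtxRow,
    vtxRow_dotProduct_mulVec_vtxRow]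
  ring

/-- **eq. (AB) AS PRINTED** for `𝒜`: `𝒜(x)_{e,h} = (1/(x_e x_h)) (ℳ°_{u_e,u_h} + ℳ°_{v_e,v_h} − ℳ°_{u_e,v_h} − ℳ°_{v_e,u_h})`.
[cite: BorinskyMunchTellander2023, §4.2 eq. (AB) (main.tex l.1064–1066)] -/
theorem scriptA_eq_rootExt (P : Matrix (Fin (V + 1)) (Fin (V + 1)) 𝕜) (x : Fin N → 𝕜) (e h : Fin N) :
    scriptA E P x e h = (x e * x h)⁻¹ *
      (rootExt (scriptM E P x) (E e).1 (E h).1 + rootExt (scriptM E P x) (E e).2 (E h).2 -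
        rootExt (scriptM E P x) (E e).1 (E h).2 - rootExt (scriptM E P x) (E e).2 (E h).1) := by
  rw [scriptA, incRow_dotProduct_mulVec]

/-- **eq. (AB) AS PRINTED** for `ℬ`. [cite: BorinskyMunchTellander2023, §4.2 eq. (AB) (main.tex l.1064–1066)] -/
theorem scriptB_eq_rootExt (x : Fin N → 𝕜) (e h : Fin N) :
    scriptB E x e h = (x e * x h)⁻¹ *
      (rootExt (laplacian E x)⁻¹ (E e).1 (E h).1 + rootExt (laplacian E x)⁻¹ (E e).2 (E h).2 -
        rootExt (laplacian E x)⁻¹ (E e).1 (E h).2 - rootExt (laplacian E x)⁻¹ (E e).2 (E h).1) := by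
  rw [scriptB, incRow_dotProduct_mulVec]

/-- **eq. (diffV), FIRST FORMULA: `∂𝒱/∂x_e (x) = −𝒜(x)_{e,e} + m_e²`** at every point with all `x_e ≠ 0` and `det 𝓛(x) ≠ 0`
(partial derivative along the `e`-th edge variable). [cite: BorinskyMunchTellander2023, §4.2 eq. (diffV) (main.tex l.1068–1070)] -/
theorem hasDerivAt_quotientV_update (P : Matrix (Fin (V + 1)) (Fin (V + 1)) 𝕜) (m : Fin N → 𝕜) (x : Fin N → 𝕜)
    {e : Fin N} (hxe : x e ≠ 0) (hdet : (laplacian E x).det ≠ 0) :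
    HasDerivAt (fun t => quotientV E P m (Function.update x e t)) (-(scriptA E P x e e) + m e ^ 2) (x e) := by
  unfold quotientV
  -- the 𝓛⁻¹ part
  set B := (laplacian E x)⁻¹ with hBdef
  set w : Fin V → 𝕜 := B *ᵥ incRow E e with hw
  have h1 : HasDerivAt (fun t => ∑ i : Fin V, ∑ k : Fin V, P i.succ k.succ * (laplacian E (Function.update x e t))⁻¹ i k)
      (∑ i : Fin V, ∑ k : Fin V, P i.succ k.succ * ((x e ^ 2)⁻¹ * (w i * w k))) (x e) := by
    refine HasDerivAt.fun_sum fun i _ => HasDerivAt.fun_sum fun k _ => ?_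
    exact (hasDerivAt_inv_laplacian_update E x hxe hdet i k).const_mul _
  -- the mass part
  have h2 : HasDerivAt (fun t => ∑ e', m e' ^ 2 * Function.update x e t e') (m e ^ 2) (x e) := by
    have key : ∀ e', HasDerivAt (fun t => m e' ^ 2 * Function.update x e t e') (if e' = e then m e ^ 2 else 0) (x e) := by
      intro e'
      by_cases h : e' = e
      · subst h
        simp only [Function.update_self, if_true]
        simpa using (hasDerivAt_id (x e')).const_mul (m e' ^ 2)
      · simp only [Function.update_of_ne h, if_neg h]
        exact hasDerivAt_const _ _
    have hs := HasDerivAt.fun_sum (u := Finset.univ) fun e' _ => key e'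
    rwa [Finset.sum_ite_eq' Finset.univ e, if_pos (Finset.mem_univ e)] at hs
  refine (h1.neg.add h2).congr_deriv ?_
  congr 1
  -- Σ_{ik} P_{i+1,k+1} x_e⁻² w_i w_k = x_e⁻² · rᵀ B P' B r = 𝒜_{ee}
  rw [scriptA, scriptM, ← pow_two]
  have hsum : ∑ i : Fin V, ∑ k : Fin V, P i.succ k.succ * ((x e ^ 2)⁻¹ * (w i * w k)) =
      (x e ^ 2)⁻¹ * (w ⬝ᵥ P.submatrix Fin.succ Fin.succ *ᵥ w) := by
    simp only [dotProduct, mulVec, Matrix.submatrix_apply, Finset.mul_sum]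
    refine Finset.sum_congr rfl fun i _ => Finset.sum_congr rfl fun k _ => ?_
    ring
  rw [hsum]
  congr 2
  -- w ⬝ᵥ P' *ᵥ w = r ⬝ᵥ (B * P' * B) *ᵥ r
  rw [hw, ← mulVec_mulVec, ← mulVec_mulVec, dotProduct_mulVec (incRow E e) B, hBdef, incRow_vecMul_inv_laplacian]

/-- The same at real positive edge variables on a connected graph (`det 𝓛(x) > 0`).
[cite: BorinskyMunchTellander2023, §4.2 eq. (diffV) (main.tex l.1068–1070)] -/
theorem hasDerivAt_quotientV_update_of_pos (hconn : IsConnectedEdgeList E) (P : Matrix (Fin (V + 1)) (Fin (V + 1)) ℝ)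
    (m : Fin N → ℝ) {x : Fin N → ℝ} (hx : ∀ e, 0 < x e) (e : Fin N) :
    HasDerivAt (fun t => quotientV E P m (Function.update x e t)) (-(scriptA E P x e e) + m e ^ 2) (x e) :=
  hasDerivAt_quotientV_update E P m x (hx e).ne' (det_laplacian_pos E hconn x hx).ne'

/-! ### Part 4 — eq. (diffV), second formula: `∂²𝒱/∂x_e∂x_h = 2δ_{e,h} 𝒜_{e,e}/x_e − 2 (𝒜 ∘ ℬ)_{e,h}` -/

/-- `vecMulVec a b *ᵥ v = (b·v) a`. [folklore] -/
private theorem vecMulVec_mulVec_eq {ι : Type*} [Fintype ι] (a b v : ι → 𝕜) :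
    vecMulVec a b *ᵥ v = (b ⬝ᵥ v) • a := by
  ext i
  simp only [Matrix.mulVec, dotProduct, vecMulVec_apply, Pi.smul_apply, smul_eq_mul, Finset.sum_mul]
  exact Finset.sum_congr rfl fun j _ => by ring

/-- For symmetric `B`, `S` and any `w`, `r`: `rᵀ (w wᵀ S B + B S w wᵀ) r = 2 (r·w) (rᵀ B S w)`. [folklore] -/
private theorem quadForm_rankOne_symm {ι : Type*} [Fintype ι] {B S : Matrix ι ι 𝕜} (hB : Bᵀ = B) (hS : Sᵀ = S)
    (w r : ι → 𝕜) :
    r ⬝ᵥ (vecMulVec w w * S * B + B * S * vecMulVec w w) *ᵥ r = 2 * (r ⬝ᵥ w) * (r ⬝ᵥ (B * S) *ᵥ w) := by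
  have h1 : r ⬝ᵥ (vecMulVec w w * S * B) *ᵥ r = (r ⬝ᵥ w) * (r ⬝ᵥ (B * S) *ᵥ w) := by
    rw [vecMulVec_mul, vecMulVec_mul, vecMulVec_mulVec_eq, dotProduct_smul, smul_eq_mul, mul_comm]
    congr 1
    rw [← dotProduct_mulVec, ← dotProduct_mulVec, mulVec_mulVec, dotProduct_mulVec w (S * B) r, dotProduct_comm,
      ← mulVec_transpose, Matrix.transpose_mul, hB, hS]
  have h2 : r ⬝ᵥ (B * S * vecMulVec w w) *ᵥ r = (r ⬝ᵥ w) * (r ⬝ᵥ (B * S) *ᵥ w) := by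
    rw [mul_vecMulVec, vecMulVec_mulVec_eq, dotProduct_smul, smul_eq_mul, dotProduct_comm w r]
  rw [add_mulVec, dotProduct_add, h1, h2]
  ring

/-- `ℳ` is symmetric for symmetric `𝒫`. [cite: BorinskyMunchTellander2023, §4.2 (main.tex l.1062–1063)] -/
theorem transpose_scriptM {P : Matrix (Fin (V + 1)) (Fin (V + 1)) 𝕜} (hP : P.IsSymm) (x : Fin N → 𝕜) :
    (scriptM E P x)ᵀ = scriptM E P x := by
  have hs := isSymm_inv_laplacian E x
  unfold Matrix.IsSymm at hs
  have hP' : (P.submatrix Fin.succ Fin.succ)ᵀ = P.submatrix Fin.succ Fin.succ := by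
    ext i k
    simp only [Matrix.transpose_apply, Matrix.submatrix_apply]
    exact hP.apply _ _
  rw [scriptM, Matrix.transpose_mul, Matrix.transpose_mul, hs, hP', Matrix.mul_assoc]

/-- **`∂ℳ(x)_{ik}/∂x_h = (D 𝒫 𝓛⁻¹ + 𝓛⁻¹ 𝒫 D)_{ik}` with `D = ∂𝓛⁻¹/∂x_h = x_h⁻² (𝓛⁻¹ r_h)(𝓛⁻¹ r_h)ᵀ`** (product rule on
`ℳ = 𝓛⁻¹𝒫𝓛⁻¹`). [cite: BorinskyMunchTellander2023, §4.2 (main.tex l.1062–1067)] -/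
theorem hasDerivAt_scriptM_update_apply (P : Matrix (Fin (V + 1)) (Fin (V + 1)) 𝕜) (x : Fin N → 𝕜) {h : Fin N}
    (hxh : x h ≠ 0) (hdet : (laplacian E x).det ≠ 0) (i k : Fin V) :
    HasDerivAt (fun t => scriptM E P (Function.update x h t) i k)
      ((((x h ^ 2)⁻¹ • vecMulVec ((laplacian E x)⁻¹ *ᵥ incRow E h) ((laplacian E x)⁻¹ *ᵥ incRow E h)) *
            P.submatrix Fin.succ Fin.succ * (laplacian E x)⁻¹ +
          (laplacian E x)⁻¹ * P.submatrix Fin.succ Fin.succ *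
            ((x h ^ 2)⁻¹ • vecMulVec ((laplacian E x)⁻¹ *ᵥ incRow E h) ((laplacian E x)⁻¹ *ᵥ incRow E h))) i k)
      (x h) := by
  set B := (laplacian E x)⁻¹ with hBdef
  set P' := P.submatrix Fin.succ Fin.succ with hP'def
  set w := B *ᵥ incRow E h with hwdef
  set D : Matrix (Fin V) (Fin V) 𝕜 := (x h ^ 2)⁻¹ • vecMulVec w w with hDdef
  have hB : ∀ a b, HasDerivAt (fun t => (laplacian E (Function.update x h t))⁻¹ a b) (D a b) (x h) := fun a b => by
    simpa only [hDdef, Matrix.smul_apply, vecMulVec_apply, smul_eq_mul] using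
      hasDerivAt_inv_laplacian_update E x hxh hdet a b
  have hterm : ∀ b, HasDerivAt
      (fun t => (∑ a, (laplacian E (Function.update x h t))⁻¹ i a * P' a b) * (laplacian E (Function.update x h t))⁻¹ b k)
      ((∑ a, D i a * P' a b) * B b k + (∑ a, B i a * P' a b) * D b k) (x h) := by
    intro b
    have h1 : HasDerivAt (fun t => ∑ a, (laplacian E (Function.update x h t))⁻¹ i a * P' a b)
        (∑ a, D i a * P' a b) (x h) :=
      HasDerivAt.fun_sum fun a _ => (hB i a).mul_const _
    have h2 := h1.mul (hB b k)
    simp only [Function.update_eq_self] at h2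
    exact h2
  have hs := HasDerivAt.fun_sum (u := Finset.univ) fun b _ => hterm b
  simp only [scriptM, Matrix.mul_apply]
  refine hs.congr_deriv ?_
  simp only [Matrix.add_apply, Matrix.mul_apply, Finset.sum_add_distrib]

/-- **`∂(r_eᵀ ℳ r_e)/∂x_h = r_eᵀ (∂ℳ/∂x_h) r_e = 2 x_e² 𝒜_{e,h} ℬ_{e,h}`** for symmetric `𝒫` (the chain behind eq. (diffV)'s second formula).
[cite: BorinskyMunchTellander2023, §4.2 eq. (AB)–(diffV) (main.tex l.1062–1072)] -/
theorem hasDerivAt_quadForm_scriptM_update {P : Matrix (Fin (V + 1)) (Fin (V + 1)) 𝕜} (hP : P.IsSymm) (x : Fin N → 𝕜)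
    {e h : Fin N} (hxe : x e ≠ 0) (hxh : x h ≠ 0) (hdet : (laplacian E x).det ≠ 0) :
    HasDerivAt (fun t => incRow E e ⬝ᵥ scriptM E P (Function.update x h t) *ᵥ incRow E e)
      (2 * x e ^ 2 * (scriptA E P x e h * scriptB E x e h)) (x h) := by
  set B := (laplacian E x)⁻¹ with hBdef
  set P' := P.submatrix Fin.succ Fin.succ with hP'def
  set w := B *ᵥ incRow E h with hwdef
  set D : Matrix (Fin V) (Fin V) 𝕜 := (x h ^ 2)⁻¹ • vecMulVec w w with hDdef
  have hM : ∀ i k, HasDerivAt (fun t => scriptM E P (Function.update x h t) i k) ((D * P' * B + B * P' * D) i k) (x h) :=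
    fun i k => hasDerivAt_scriptM_update_apply E P x hxh hdet i k
  have hQ : HasDerivAt (fun t => incRow E e ⬝ᵥ scriptM E P (Function.update x h t) *ᵥ incRow E e)
      (incRow E e ⬝ᵥ (D * P' * B + B * P' * D) *ᵥ incRow E e) (x h) := by
    simp only [dotProduct, Matrix.mulVec]
    exact HasDerivAt.fun_sum fun i _ =>
      (HasDerivAt.fun_sum fun k _ => (hM i k).mul_const _).const_mul _
  refine hQ.congr_deriv ?_
  -- algebra: pull out the scalar, use the rank-one identity, identify 𝒜 and ℬ
  have hBsymm : Bᵀ = B := isSymm_inv_laplacian E x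
  have hP's : P'ᵀ = P' := by
    ext i k
    simp only [hP'def, Matrix.transpose_apply, Matrix.submatrix_apply]
    exact hP.apply _ _
  have hsplit : D * P' * B + B * P' * D = (x h ^ 2)⁻¹ • (vecMulVec w w * P' * B + B * P' * vecMulVec w w) := by
    rw [hDdef, Matrix.smul_mul, Matrix.smul_mul, Matrix.mul_smul, smul_add]
  rw [hsplit, smul_mulVec, dotProduct_smul, smul_eq_mul, quadForm_rankOne_symm hBsymm hP's]
  have hA : incRow E e ⬝ᵥ (B * P') *ᵥ w = (x e * x h) * scriptA E P x e h := by
    rw [scriptA, ← mul_assoc, mul_inv_cancel₀ (mul_ne_zero hxe hxh), one_mul, scriptM, ← hBdef, ← hP'def, hwdef,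
      mulVec_mulVec]
  have hBv : incRow E e ⬝ᵥ w = (x e * x h) * scriptB E x e h := by
    rw [scriptB, ← mul_assoc, mul_inv_cancel₀ (mul_ne_zero hxe hxh), one_mul]
  rw [hA, hBv]
  have hxh2 : x h ^ 2 ≠ 0 := pow_ne_zero 2 hxh
  calc _ = (x h ^ 2)⁻¹ * x h ^ 2 * (2 * x e ^ 2 * (scriptA E P x e h * scriptB E x e h)) := by ring
    _ = _ := by rw [inv_mul_cancel₀ hxh2, one_mul]

/-- **eq. (diffV), SECOND FORMULA: `∂²𝒱/∂x_e∂x_h (x) = 2δ_{e,h} 𝒜(x)_{e,e}/x_e − 2 (𝒜(x) ∘ ℬ(x))_{e,h}`** («where we use the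
Hadamard or element-wise matrix product (𝒜∘ℬ)_{e,h} = 𝒜_{e,h}·ℬ_{e,h}»): the derivative along `x_h` of the first partial
`∂𝒱/∂x_e = −𝒜_{e,e} + m_e²` of the first formula, for symmetric `𝒫`, all `x_e ≠ 0` and `det 𝓛(x) ≠ 0`.
[cite: BorinskyMunchTellander2023, §4.2 eq. (diffV) (main.tex l.1068–1072)] -/
theorem hasDerivAt_partialV_update {P : Matrix (Fin (V + 1)) (Fin (V + 1)) 𝕜} (hP : P.IsSymm) (m : Fin N → 𝕜)
    (x : Fin N → 𝕜) (hx : ∀ e, x e ≠ 0) (hdet : (laplacian E x).det ≠ 0) (e h : Fin N) :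
    HasDerivAt (fun t => -(scriptA E P (Function.update x h t) e e) + m e ^ 2)
      (2 * (if e = h then scriptA E P x e e / x e else 0) - 2 * (scriptA E P x e h * scriptB E x e h)) (x h) := by
  have hxe := hx e
  have hxh := hx h
  -- the quadratic form `Q(t) = r_eᵀ ℳ(x with x_h := t) r_e`
  have hQ := hasDerivAt_quadForm_scriptM_update E hP x hxe hxh hdet (e := e) (h := h)
  -- the prefactor `f(t) = ((x with x_h := t)_e)⁻²`
  have hf : HasDerivAt (fun t => (Function.update x h t e * Function.update x h t e)⁻¹)
      (if e = h then -(2 * x e) / (x e * x e) ^ 2 else 0) (x h) := by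
    by_cases heh : e = h
    · subst heh
      simp only [Function.update_self, if_true]
      have hc : HasDerivAt (fun t => t * t) (1 * x e + x e * 1) (x e) := (hasDerivAt_id _).mul (hasDerivAt_id _)
      refine (hc.inv (mul_ne_zero hxe hxe)).congr_deriv ?_
      ring
    · simp only [Function.update_of_ne heh, if_neg heh]
      exact hasDerivAt_const _ _
  have hA : HasDerivAt (fun t => scriptA E P (Function.update x h t) e e)
      ((if e = h then -(2 * x e) / (x e * x e) ^ 2 else 0) *
          (incRow E e ⬝ᵥ scriptM E P (Function.update x h (x h)) *ᵥ incRow E e) +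
        (Function.update x h (x h) e * Function.update x h (x h) e)⁻¹ * (2 * x e ^ 2 * (scriptA E P x e h * scriptB E x e h)))
      (x h) := by
    unfold scriptA
    exact hf.mul hQ
  simp only [Function.update_eq_self] at hA
  refine (hA.neg.add_const (m e ^ 2)).congr_deriv ?_
  -- identify `r_eᵀ ℳ(x) r_e = x_e² 𝒜_{e,e}` and simplify
  have hQ0 : incRow E e ⬝ᵥ scriptM E P x *ᵥ incRow E e = (x e * x e) * scriptA E P x e e := by
    rw [scriptA, ← mul_assoc, mul_inv_cancel₀ (mul_ne_zero hxe hxe), one_mul]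
  rw [hQ0]
  by_cases heh : e = h
  · subst heh
    simp only [if_true]
    field_simp
    ring
  · simp only [if_neg heh]
    field_simp
    ring

/-- The second formula at real positive edge variables on a connected graph. [cite: BorinskyMunchTellander2023, §4.2 eq. (diffV) (main.tex l.1068–1072)] -/
theorem hasDerivAt_partialV_update_of_pos (hconn : IsConnectedEdgeList E) {P : Matrix (Fin (V + 1)) (Fin (V + 1)) ℝ}
    (hP : P.IsSymm) (m : Fin N → ℝ) {x : Fin N → ℝ} (hx : ∀ e, 0 < x e) (e h : Fin N) :
    HasDerivAt (fun t => -(scriptA E P (Function.update x h t) e e) + m e ^ 2)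
      (2 * (if e = h then scriptA E P x e e / x e else 0) - 2 * (scriptA E P x e h * scriptB E x e h)) (x h) :=
  hasDerivAt_partialV_update E hP m x (fun e => (hx e).ne') (det_laplacian_pos E hconn x hx).ne' e h

end DiffV

end Literature.MathematicalPhysics.QuantumFieldTheory.BorinskyMunchTellander2023

end
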